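import Summits.BirchSwinnertonDyer.BirchSwinnertonDyer.Theorems.UniversalToricDescentSigmaCongruenceAtThreeIffInvariantPair
import Summits.BirchSwinnertonDyer.BirchSwinnertonDyer.Theorems.UniversalToricDescentDefectTransportModThreePTOfSigmaCongruence
import Summits.BirchSwinnertonDyer.BirchSwinnertonDyer.Theorems.UniversalToricDescentDefectTransportModThreePTOfLambdaLe
import HarnessLib

/-!
# NODE (D-0171) for crux A = `SigmaCongruenceAtThree` (stmt-BirchSwinnertonDyer-27120, route `UniversalToricDescent`)
# idea `universal-period-pair` — crux-ideate standing cover, unit `cruxidea-stmt-BirchSwinnertonDyer-27120-1-g4` (gen 4, 2026-08-30)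

LEVER (one sentence).  The wild Σ-imprimitive frame `𝓛·Π_E(e)` of A — with the TRUE Frobenius exponents `e_v = κ(σ_v)`,
not mirror exponents — is, up to a non-zero constant and a unit, the PRODUCT `𝒫⁺·𝒫⁻` of the two UNIVERSAL TORUS PERIODS of
Liu–Zhang–Zhang (Duke 2018 = arXiv:1511.08172, §4.2 Def. 4.10, §4.3 Cor. 4.13, §4.4 Def. 4.17) of the Σ-depleted new vector of
`π_E`, which is a STABLE (= `U_𝔭`-killed, infinite-slope) vector because `π_{E,3}` is supercuspidal (`27 ∣ N`; LZZ §3.4: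
`𝓛⁻¹_𝔭(π) = 1` for supercuspidal `π_𝔭`, no `𝔭`-stabilisation); the twin's frame is likewise `c′·𝒫′⁺·𝒫′⁻` for the
`𝔭`-stabilised Σ-depleted vector of `π_{E′}`; and `f ↦ 𝒫^±(f)` is ONE LINEAR map on stable convergent modular forms on the
infinite-level Igusa tower (global Mellin transform, LZZ Thm. 2.x `th:family`), so the `q`-expansion congruence of the two
depleted vectors gives `𝒫^± ≡ 𝒫′^± (mod 𝔪)` and A follows by profile algebra that never evaluates a constant.

PIECES and TAGS (evidence in the docstrings below and in `Ideas/universal-period-pair.md`):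
* `UniversalPeriodPairAtThree` — STRONGER than A as a statement (product shape is extra), WEAKER than the registered line's
  `stub_sqrtToricFunctional ∧ stub_heckeCongruence` (`Lines/sqrt_toric_functional.lean`: take `P = Q := Θ g_E`,
  `P′ = Q′ := Θ g_{E′}`, congruence from linearity + Hecke congruence by `forall_norm_coeff_sub_lt_one_of_dvd`) · TRANSFER
  (from LZZ's general `p`-adic Waldspurger theorem, which covers the wild member verbatim) · UNDECIDED.
  Leaves: (U1) wild product identity — ATTACKABLE by citation/port [LZZ Def. 4.10 + Cor. 4.13 + Def. 4.17 + frame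
  uniqueness]; (U2) twin product identity + `μ = 0` of the twin roots — ATTACKABLE by citation [LZZ idem for `π_{E′}`;
  Hsieh 2014 Thm. B / Castella–Hsieh 2018 canonical normalisation]; (U3) root congruence — ATTACKABLE (M/L): linearity of
  `𝒫^±` (definitional) + integrality of the Mellin/Amice transform of an integral form + `q`-expansion principle on the
  Igusa tower (Katz) + Hecke congruence of the depleted eigen-sequences (the line's stub H); INSTRUMENTABLE sub-leaf: the
  exact constant bookkeeping `|Cl|⁻¹`, `Ω_lt^{-k}` in Def. 4.10 is common to `E` and `E′` (same `K`, same tame level).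
* `UniversalPeriodDominanceAtThree` (§4) — the ONE-SIDED version (twin roots ≡ MULTIPLES of the wild roots mod `𝔪`): WEAKER
  than U (`universalPeriodDominance_of_universalPeriodPair`, proved) · UNDECIDED; it is exactly the currency of the parent ♭T≤,
  which needs only `λ(𝓛Π_E) ≤ λ(𝓛′Π_{E′})`.
* compositions `sigmaCongruenceAtThree_of_universalPeriodPair` (A BY NAME, given the route's Thm-B input = item 27933 /
  `closes` binder), `defectTransportModThreePT_of_universalPeriodPair` and `defectTransportModThreePT_of_universalPeriodDominance`
  (the parent ♭T≤ = stmt-23042 BY NAME, the latter via p706556 `defectTransportModThreePT_of_thmB_of_lambdaLe`) are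
  kernel-checked below, no `sorry`.
NOT EQUIV to A (A does not give the product shape), so no child is owed (D-0171).  Disproof used: none exists for this crux
(`ledger crux ls stmt-BirchSwinnertonDyer-27120`: no `Disproof.lean`, no `Negative/`).
-/

noncomputable section

open scoped Classical

namespace Summit.BirchSwinnertonDyer.BirchSwinnertonDyer.Cruxes.SigmaCongruenceAtThree.UniversalPeriodPair

open NumberField IsDedekindDomain
open Literature.NumberTheory.EllipticCurves Literature.NumberTheory.EllipticCurves.GreenbergVatsal2000
  Summit.BirchSwinnertonDyer.Rank1Residual.X11b
  Summit.BirchSwinnertonDyer.BirchSwinnertonDyer.Theorems.UniversalToricDescentNormProfile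
  Summit.BirchSwinnertonDyer.BirchSwinnertonDyer.Theorems.UniversalToricDescentAcEulerFactor
  Summit.BirchSwinnertonDyer.BirchSwinnertonDyer.Theorems
  Summit.BirchSwinnertonDyer.BirchSwinnertonDyer.Theses.UniversalToricDescent

/-! ### §1 The piece -/

/-- **Piece U — UNIVERSAL PERIOD PAIR at `p = 3`** (tags: STRONGER than A · WEAKER than the line's F ∧ H · TRANSFER ·
UNDECIDED; leaves U1/U2 ATTACKABLE-by-citation, U3 ATTACKABLE).  On A's own binders: there are exponents `e_v ≠ 0` of exact
valuation `c_v` (in nature the TRUE Frobenius exponents `κ(σ_v)`, `e_{v̄} = −e_v`) and four series `P, Q, P′, Q′ ∈ R₀⟦T⟧`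
(in nature `P = 𝒫⁺_un(f_E^{[Σ]})`, `Q = 𝒫⁻_un(f_E^{[Σ]})`, `P′ = 𝒫⁺_un(f_{E′}^{[Σ3]})`, `Q′ = 𝒫⁻_un(f_{E′}^{[Σ3]})`, the
Liu–Zhang–Zhang universal torus periods of the depleted stable vectors, integrally normalised) with
(wild) `C a·(𝓛·Π_E(e)) = C b·(w·P·Q)`, `a, b ∈ R₀ ∖ {0}`, `w` a unit — LZZ Cor. 4.13/Def. 4.17: `𝒫⁺𝒫⁻ = 𝓛(π_E)·𝒬(f, f)`
with `𝒬` the local period distribution of the depleted vector = constant × `∏_{ℓ∈Σ} P_𝔩 P_𝔩̄` at the true exponents, and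
the supercuspidal new vector is stable with `𝓛⁻¹_𝔭 = 1`;
(twin) the same for `𝓛′·Π_{E′}(e)` and `P′, Q′`;
(μ′) `P′` and `Q′` each have a coefficient of norm `1` (Hsieh's `μ = 0` for the canonically normalised CM-sum of the TAME twin);
(congruence) `P ≡ P′`, `Q ≡ Q′ (mod 𝔪)` coefficientwise (linearity of `f ↦ 𝒫^±(f)` + integrality + `q`-expansion congruence
of the depleted vectors).  No constant at `27 ∣ N` is asserted to be a unit and no functional appears in the STATEMENT.
Why it might fail: LZZ work with coefficients in a FIELD `K ⊇ M F_𝔭^{lt}`; the integral refinement "`𝒫^±` of a form with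
`3`-integral Serre–Tate expansions is an `R₀`-valued measure, and of `3·g` is `3·(measure)`" is folklore (Amice transform of
an integral power series) but unprinted in their formalism; the class-number factor `|E^×\𝔸^{∞×}_E/V^𝔭 O^×_{𝔭,m}|⁻¹` of
Def. 4.10 is a common constant, absorbed in `a, b, a′, b′`.
[cite: LiuZhangZhang2018 = arXiv:1511.08172, Def. 2.15 (stable), Def. 4.10 (universal torus period), Prop. 4.12, Cor. 4.13,
Def. 4.17, §3.4 (`𝓛⁻¹ = 1` for supercuspidal); p. 3 "no control of ramification on representations, characters, or test
vectors"] [cite: Hsieh2014, Thm. B] [cite: CastellaHsieh2018, §3] [cite: GreenbergVatsal2000, Thm. (1.5)]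
[cite: Katz1978 (q-expansion principle / Serre–Tate), Gouvea1988 §I.3] -/
def UniversalPeriodPairAtThree : Prop :=
      ∀ (W : WeierstrassCurve ℚ) [W.IsElliptic] [W.IsGloballyMinimal] (W' : WeierstrassCurve ℚ) [W'.IsElliptic]
      [W'.IsGloballyMinimal] (N N' : ℕ) [NeZero N] [NeZero N'] (K : Type) [Field K] [NumberField K] (Dt :
      Literature.NumberTheory.EllipticCurves.ModularForms.ModularParametrizationData W N) (Dt' :
      Literature.NumberTheory.EllipticCurves.ModularForms.ModularParametrizationData W' N'),
      Summit.BirchSwinnertonDyer.Rank1Residual.Additive.ClassO6 W 3 → W.HasSurjectiveModNGaloisRep 3 →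
      W.analyticRank = 1 → W.conductorNorm ℤ = N → Summit.BirchSwinnertonDyer.Rank1Residual.O6.ModPCongruent W' W
      3 → ¬ Literature.NumberTheory.EllipticCurves.Rank1Residual.Addv W' 3 → W'.conductorNorm ℤ = N' →
      Literature.NumberTheory.EllipticCurves.IsImaginaryQuadratic K →
      Literature.NumberTheory.EllipticCurves.SatisfiesHeegnerHypothesis N K →
      Literature.NumberTheory.EllipticCurves.SatisfiesHeegnerHypothesis N' K → ∀ (κ :
      Literature.NumberTheory.EllipticCurves.ZpExtension K 3), κ.IsAnticyclotomic → ∀ (γ :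
      Field.absoluteGaloisGroup K) [Fact (κ.IsTopGenerator γ)] (𝔭 : IsDedekindDomain.HeightOneSpectrum
      (NumberField.RingOfIntegers K)), ((3 : ℕ) : NumberField.RingOfIntegers K) ∈ 𝔭.asIdeal →
      𝔭.asIdeal.ramificationIdx (NumberField.RingOfIntegers ℚ) = 1 → 𝔭.asIdeal.inertiaDeg
      (NumberField.RingOfIntegers ℚ) = 1 → ∀ (𝔭' : IsDedekindDomain.HeightOneSpectrum (NumberField.RingOfIntegers
      K)), ((3 : ℕ) : NumberField.RingOfIntegers K) ∈ 𝔭'.asIdeal → 𝔭' ≠ 𝔭 → ∀ (ι' : PadicAlgCl 3 ≃+* ℂ),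
      Summit.BirchSwinnertonDyer.BirchSwinnertonDyer.Theorems.SchneiderFree.BranchInducesPrime 3 ι' 𝔭 → ∀ (ΩK : ℂ)
      (Ωp : ℂ_[3]) (L : Literature.NumberTheory.EllipticCurves.UnrSeries 3), ΩK ≠ 0 → Ωp ≠ 0 →
      Literature.NumberTheory.EllipticCurves.IsBDPLFunction ι' 𝔭 κ γ Dt.f ΩK Ωp L → ∀ (ΩK' : ℂ) (Ωp' : ℂ_[3]) (L'
      : Literature.NumberTheory.EllipticCurves.UnrSeries 3), ΩK' ≠ 0 → Ωp' ≠ 0 →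
      Literature.NumberTheory.EllipticCurves.IsBDPLFunction ι' 𝔭 κ γ Dt'.f ΩK' Ωp' L' → (∃ i : ℕ,
      ‖((PowerSeries.coeff i L' : Literature.NumberTheory.EllipticCurves.unrIntegers 3) : ℂ_[3])‖ = 1) → ∀ (T :
      Finset (IsDedekindDomain.HeightOneSpectrum (NumberField.RingOfIntegers K))) (c :
      IsDedekindDomain.HeightOneSpectrum (NumberField.RingOfIntegers K) → ℕ), (↑T = {v :
      IsDedekindDomain.HeightOneSpectrum (NumberField.RingOfIntegers K) | ((3 : ℕ) : NumberField.RingOfIntegers K)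
      ∉ v.asIdeal ∧ (¬ (W.baseChange K).HasGoodReductionAt v ∨ ¬ (W'.baseChange K).HasGoodReductionAt v)}) → (∀ v
      ∈ T, (∃ d₀ : Literature.NumberTheory.EllipticCurves.GreenbergSelmer.decomp (K := K) v, (κ (d₀ :
      Field.absoluteGaloisGroup K)).toAdd = (3 : ℤ_[3]) ^ c v) ∧ (∀ d :
      Literature.NumberTheory.EllipticCurves.GreenbergSelmer.decomp (K := K) v, (3 : ℤ_[3]) ^ c v ∣ (κ (d :
      Field.absoluteGaloisGroup K)).toAdd)) →
      ∃ (e : IsDedekindDomain.HeightOneSpectrum (NumberField.RingOfIntegers K) → ℤ_[3]),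
        (∀ v ∈ T, e v ≠ 0 ∧ (e v).valuation = c v) ∧
        ∃ (P Q P' Q' : Literature.NumberTheory.EllipticCurves.UnrSeries 3),
        (∃ (a b : Literature.NumberTheory.EllipticCurves.unrIntegers 3)
            (w : Literature.NumberTheory.EllipticCurves.UnrSeries 3), a ≠ 0 ∧ b ≠ 0 ∧ IsUnit w ∧
          PowerSeries.C a * (L * PowerSeries.map (Summit.BirchSwinnertonDyer.Rank1Residual.X11b.Halves.toUnr 3)
            (∏ v ∈ T, (Polynomial.aeval
              (PowerSeries.C ((Nat.card (IsLocalRing.ResidueField (v.adicCompletionIntegers K)) : ℤ_[3]).inv) *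
                PowerSeries.binomialSeries ℤ_[3] (e v)) ((W.baseChange K).localPolynomialAt v) :
              Literature.NumberTheory.EllipticCurves.IwasawaAlgebra 3))) =
          PowerSeries.C b * (w * (P * Q))) ∧
        (∃ (a' b' : Literature.NumberTheory.EllipticCurves.unrIntegers 3)
            (w' : Literature.NumberTheory.EllipticCurves.UnrSeries 3), a' ≠ 0 ∧ b' ≠ 0 ∧ IsUnit w' ∧
          PowerSeries.C a' * (L' * PowerSeries.map (Summit.BirchSwinnertonDyer.Rank1Residual.X11b.Halves.toUnr 3)
            (∏ v ∈ T, (Polynomial.aeval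
              (PowerSeries.C ((Nat.card (IsLocalRing.ResidueField (v.adicCompletionIntegers K)) : ℤ_[3]).inv) *
                PowerSeries.binomialSeries ℤ_[3] (e v)) ((W'.baseChange K).localPolynomialAt v) :
              Literature.NumberTheory.EllipticCurves.IwasawaAlgebra 3))) =
          PowerSeries.C b' * (w' * (P' * Q'))) ∧
        (∃ i : ℕ, ‖((PowerSeries.coeff i P' : Literature.NumberTheory.EllipticCurves.unrIntegers 3) : ℂ_[3])‖ = 1) ∧
        (∃ i : ℕ, ‖((PowerSeries.coeff i Q' : Literature.NumberTheory.EllipticCurves.unrIntegers 3) : ℂ_[3])‖ = 1) ∧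
        (∀ i : ℕ, ‖((PowerSeries.coeff i (P - P') : Literature.NumberTheory.EllipticCurves.unrIntegers 3) : ℂ_[3])‖ < 1) ∧
        (∀ i : ℕ, ‖((PowerSeries.coeff i (Q - Q') : Literature.NumberTheory.EllipticCurves.unrIntegers 3) : ℂ_[3])‖ < 1)

/-! ### §2 Profile algebra: constants are invisible to norm profiles -/

/-- **Two non-zero constant multiples of series with norm profiles `M, M′` are equal only if `M = M′`.**  Proof reproduced
from `Lines/sqrt_toric_functional.lean` §2 (crux-strategist g0, 2026-08-29) so that this node does not import a skeleton
with `sorry`s. [cite: Washington1997, §7.1] -/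
theorem profile_eq_of_C_mul_eq {X Y : UnrSeries 3} {a b : unrIntegers 3} {M M' : ℕ} (ha : a ≠ 0) (hb : b ≠ 0)
    (hX : (∀ i < M, ‖((PowerSeries.coeff i X : unrIntegers 3) : ℂ_[3])‖ < 1) ∧
      ‖((PowerSeries.coeff M X : unrIntegers 3) : ℂ_[3])‖ = 1)
    (hY : (∀ i < M', ‖((PowerSeries.coeff i Y : unrIntegers 3) : ℂ_[3])‖ < 1) ∧
      ‖((PowerSeries.coeff M' Y : unrIntegers 3) : ℂ_[3])‖ = 1)
    (h : PowerSeries.C a * X = PowerSeries.C b * Y) : M = M' := by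
  have key : ∀ i, ‖(a : ℂ_[3])‖ * ‖((PowerSeries.coeff i X : unrIntegers 3) : ℂ_[3])‖ =
      ‖(b : ℂ_[3])‖ * ‖((PowerSeries.coeff i Y : unrIntegers 3) : ℂ_[3])‖ := by
    intro i
    have hi := congrArg (PowerSeries.coeff i) h
    simp only [PowerSeries.coeff_C_mul] at hi
    have hi' := congrArg (fun z : unrIntegers 3 ↦ ‖(z : ℂ_[3])‖) hi
    simpa only [Subring.coe_mul, norm_mul] using hi'
  have ha' : 0 < ‖(a : ℂ_[3])‖ := norm_pos_iff.mpr (by simpa using ha)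
  have hb' : 0 < ‖(b : ℂ_[3])‖ := norm_pos_iff.mpr (by simpa using hb)
  rcases lt_trichotomy M M' with hlt | heq | hgt
  · exfalso
    have h1 := key M
    have h2 := key M'
    rw [hX.2, mul_one] at h1
    rw [hY.2, mul_one] at h2
    have hab : ‖(a : ℂ_[3])‖ < ‖(b : ℂ_[3])‖ := by
      rw [h1]; exact mul_lt_of_lt_one_right hb' (hY.1 M hlt)
    have hba : ‖(b : ℂ_[3])‖ ≤ ‖(a : ℂ_[3])‖ := by
      rw [← h2]; exact mul_le_of_le_one_right ha'.le (norm_coeff_le_one X M')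
    exact absurd hab (not_lt.mpr hba)
  · exact heq
  · exfalso
    have h1 := key M'
    have h2 := key M
    rw [hY.2, mul_one] at h1
    rw [hX.2, mul_one] at h2
    have hba : ‖(b : ℂ_[3])‖ < ‖(a : ℂ_[3])‖ := by
      rw [← h1]; exact mul_lt_of_lt_one_right ha' (hX.1 M' hgt)
    have hab : ‖(a : ℂ_[3])‖ ≤ ‖(b : ℂ_[3])‖ := by
      rw [h2]; exact mul_le_of_le_one_right hb'.le (norm_coeff_le_one Y M)
    exact absurd hba (not_lt.mpr hab)

/-! ### §3 Compositions: U (+ the route's Thm-B input) → A BY NAME → ♭T≤ BY NAME -/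

/-- **U ⇒ A** (kernel-checked, no `sorry`; `hB` is the route's own Thm-B input, item 27933 = the `closes` binder
`TwinHsiehThmBInput`).  Rewrite A as the λ-identity given Thm. B (p705895); `𝓛·Π_E(e)` has profile `m + D`,
`𝓛′·Π_{E′}(e)` profile `m′ + D′` (`D, D′ = Σ d_v·3^{v(e_v)}`, p615705); `P′, Q′` have profiles `f_P, f_Q` by (μ′), hence so
do `P, Q` by (congruence); `w·P·Q` and `w′·P′·Q′` both have profile `f_P + f_Q`; the identities force
`m + D = f_P + f_Q = m′ + D′` (`profile_eq_of_C_mul_eq`, constants never evaluated), i.e. the λ-identity after `v(e_v) = c_v`. -/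
theorem sigmaCongruenceAtThree_of_universalPeriodPair
    (hB : Literature.NumberTheory.EllipticCurves.Hsieh2014.thmB_exists_isHsiehLFunction_coeff_norm_eq_one_unrPeriod_anyLevel)
    (hU : UniversalPeriodPairAtThree) : SigmaCongruenceAtThree := by
  haveI : Fact (Nat.Prime 3) := ⟨Nat.prime_three⟩
  rw [UniversalToricDescentSigmaCongruenceInvariantPair.sigmaCongruenceAtThree_iff_lambdaIdentity_of_thmB hB]
  intro W _ _ W' _ _ N N' _ _ K _ _ Dt Dt' hO6 hsurj hrk hN hmod haddv hN' hK hH hH' κ hκ γ _ 𝔭 h𝔭 hram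
      hdeg 𝔭' h𝔭' hne ι' hι ΩK Ωp L hΩK hΩp hL ΩK' Ωp' L' hΩK' hΩp' hL' hi' T c hT hc m m' hm hm'
  obtain ⟨e, he, P, Q, P', Q', ⟨a, b, w, ha, hb, hw, hEq⟩, ⟨a', b', w', ha', hb', hw', hEq'⟩, hiP', hiQ', hcP, hcQ⟩ :=
    hU W W' N N' K Dt Dt' hO6 hsurj hrk hN hmod haddv hN' hK hH hH' κ hκ γ 𝔭 h𝔭 hram hdeg 𝔭' h𝔭' hne ι' hι ΩK Ωp L
      hΩK hΩp hL ΩK' Ωp' L' hΩK' hΩp' hL' hi' T c hT hc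
  have hT3 := UniversalToricDescentSigmaCongruenceInvariantPair.not_mem_of_coe_eq hT
  -- profiles `D, D′` of the Σ-Euler products (p615705) and of `𝓛Π_E(e)`, `𝓛′Π_{E′}(e)`
  obtain ⟨-, hordE⟩ := order_map_toZMod_prod_aeval_localPolynomialAt (W.baseChange K) T hT3 e
    (fun v hv ↦ (he v hv).1)
  obtain ⟨-, hordE'⟩ := order_map_toZMod_prod_aeval_localPolynomialAt (W'.baseChange K) T hT3 e
    (fun v hv ↦ (he v hv).1)
  have hX := normProfile_mul hm (normProfile_map_toUnr_of_order_eq _ hordE)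
  have hX' := normProfile_mul hm' (normProfile_map_toUnr_of_order_eq _ hordE')
  -- the twin roots `P′, Q′` have profiles (μ′); the wild roots `P, Q` inherit them by the congruence
  obtain ⟨fP, hFP'⟩ := UniversalToricDescentSelfMuZero.exists_normProfile_of_exists_coeff_norm_eq_one hiP'
  obtain ⟨fQ, hFQ'⟩ := UniversalToricDescentSelfMuZero.exists_normProfile_of_exists_coeff_norm_eq_one hiQ'
  have hFP := normProfile_of_forall_norm_sub_lt hcP hFP'
  have hFQ := normProfile_of_forall_norm_sub_lt hcQ hFQ'
  -- `w·P·Q` and `w′·P′·Q′` have profile `f_P + f_Q`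
  have hPQ := normProfile_mul hFP hFQ
  have hPQ' := normProfile_mul hFP' hFQ'
  have hwPQ := normProfile_mul_of_isUnit hw hPQ
  have hwPQ' := normProfile_mul_of_isUnit hw' hPQ'
  -- the constants are invisible: `m + D = f_P + f_Q = m′ + D′`
  have h1 := profile_eq_of_C_mul_eq ha hb hX hwPQ hEq
  have h2 := profile_eq_of_C_mul_eq ha' hb' hX' hwPQ' hEq'
  -- `d_v · 3^{v(e_v)} = 3^{c_v} · d_v` place by place
  have key : ∀ E : WeierstrassCurve K,
      ∑ v ∈ T, (eulerFactorModP E 3 v).rootMultiplicity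
            (((Nat.card (IsLocalRing.ResidueField (v.adicCompletionIntegers K)) : ℕ) : ZMod 3)⁻¹) *
          3 ^ (e v).valuation =
        ∑ v ∈ T, 3 ^ c v * (eulerFactorModP E 3 v).rootMultiplicity
            (((Nat.card (IsLocalRing.ResidueField (v.adicCompletionIntegers K)) : ℕ) : ZMod 3)⁻¹) :=
    fun E ↦ Finset.sum_congr rfl fun v hv ↦ by rw [(he v hv).2, mul_comm]
  rw [← key, ← key]
  omega

/-- **U ⇒ ♭T≤** (the parent crux `DefectTransportModThreePT` = stmt-BirchSwinnertonDyer-23042 BY NAME), by the landed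
composition A ⇒ ♭T≤ (`defectTransportModThreePT_of_sigmaCongruenceAtThree`, support item 27121, CLOSED·proved). -/
theorem defectTransportModThreePT_of_universalPeriodPair
    (hB : Literature.NumberTheory.EllipticCurves.Hsieh2014.thmB_exists_isHsiehLFunction_coeff_norm_eq_one_unrPeriod_anyLevel)
    (hU : UniversalPeriodPairAtThree) : DefectTransportModThreePT :=
  UniversalToricDescentDefectTransportModThreePTOfSigmaCongruence.defectTransportModThreePT_of_sigmaCongruenceAtThree
    (sigmaCongruenceAtThree_of_universalPeriodPair hB hU)

/-! ### §4 The ONE-SIDED piece the parent actually needs: root DOMINANCE ⇒ ♭T≤ -/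

/-- **Piece D — UNIVERSAL PERIOD DOMINANCE at `p = 3`** (tags: WEAKER than U (`universalPeriodDominance_of_universalPeriodPair`) ·
one-sided · UNDECIDED; same leaves U1/U2, and U3≤ = "the reduction of the twin root is a MULTIPLE of the reduction of the wild root"
instead of "equal up to 𝔪").  As U, but the wild roots `P, Q` carry their own `μ = 0` normalisation (free: divide by a power of `3`)
and the congruence is replaced by DIVISIBILITY mod `𝔪`: `P′ ≡ V·P`, `Q′ ≡ V₂·Q (mod 𝔪)` for SOME `V, V₂ ∈ R₀⟦T⟧` (not units).
This is exactly what the parent ♭T≤ (stmt-23042) consumes: it gives `λ(𝓛Π_E) ≤ λ(𝓛′Π_{E′})` (p706556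
`defectTransportModThreePT_of_thmB_of_lambdaLe`).  Why it might fail: as U (it is implied by U); it could hold where U fails only
if the depleted wild and twin vectors generate different mod-3 Hecke eigen-lines on the Igusa tower with one dividing the other —
no known mechanism, recorded for completeness of the one-sided currency. [cite: LiuZhangZhang2018 = arXiv:1511.08172, Def. 4.10,
Cor. 4.13] [cite: GreenbergVatsal2000, Thm. (1.5)] -/
def UniversalPeriodDominanceAtThree : Prop :=
      ∀ (W : WeierstrassCurve ℚ) [W.IsElliptic] [W.IsGloballyMinimal] (W' : WeierstrassCurve ℚ) [W'.IsElliptic]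
      [W'.IsGloballyMinimal] (N N' : ℕ) [NeZero N] [NeZero N'] (K : Type) [Field K] [NumberField K] (Dt :
      Literature.NumberTheory.EllipticCurves.ModularForms.ModularParametrizationData W N) (Dt' :
      Literature.NumberTheory.EllipticCurves.ModularForms.ModularParametrizationData W' N'),
      Summit.BirchSwinnertonDyer.Rank1Residual.Additive.ClassO6 W 3 → W.HasSurjectiveModNGaloisRep 3 →
      W.analyticRank = 1 → W.conductorNorm ℤ = N → Summit.BirchSwinnertonDyer.Rank1Residual.O6.ModPCongruent W' W
      3 → ¬ Literature.NumberTheory.EllipticCurves.Rank1Residual.Addv W' 3 → W'.conductorNorm ℤ = N' →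
      Literature.NumberTheory.EllipticCurves.IsImaginaryQuadratic K →
      Literature.NumberTheory.EllipticCurves.SatisfiesHeegnerHypothesis N K →
      Literature.NumberTheory.EllipticCurves.SatisfiesHeegnerHypothesis N' K → ∀ (κ :
      Literature.NumberTheory.EllipticCurves.ZpExtension K 3), κ.IsAnticyclotomic → ∀ (γ :
      Field.absoluteGaloisGroup K) [Fact (κ.IsTopGenerator γ)] (𝔭 : IsDedekindDomain.HeightOneSpectrum
      (NumberField.RingOfIntegers K)), ((3 : ℕ) : NumberField.RingOfIntegers K) ∈ 𝔭.asIdeal →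
      𝔭.asIdeal.ramificationIdx (NumberField.RingOfIntegers ℚ) = 1 → 𝔭.asIdeal.inertiaDeg
      (NumberField.RingOfIntegers ℚ) = 1 → ∀ (𝔭' : IsDedekindDomain.HeightOneSpectrum (NumberField.RingOfIntegers
      K)), ((3 : ℕ) : NumberField.RingOfIntegers K) ∈ 𝔭'.asIdeal → 𝔭' ≠ 𝔭 → ∀ (ι' : PadicAlgCl 3 ≃+* ℂ),
      Summit.BirchSwinnertonDyer.BirchSwinnertonDyer.Theorems.SchneiderFree.BranchInducesPrime 3 ι' 𝔭 → ∀ (ΩK : ℂ)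
      (Ωp : ℂ_[3]) (L : Literature.NumberTheory.EllipticCurves.UnrSeries 3), ΩK ≠ 0 → Ωp ≠ 0 →
      Literature.NumberTheory.EllipticCurves.IsBDPLFunction ι' 𝔭 κ γ Dt.f ΩK Ωp L → ∀ (ΩK' : ℂ) (Ωp' : ℂ_[3]) (L'
      : Literature.NumberTheory.EllipticCurves.UnrSeries 3), ΩK' ≠ 0 → Ωp' ≠ 0 →
      Literature.NumberTheory.EllipticCurves.IsBDPLFunction ι' 𝔭 κ γ Dt'.f ΩK' Ωp' L' → (∃ i : ℕ,
      ‖((PowerSeries.coeff i L' : Literature.NumberTheory.EllipticCurves.unrIntegers 3) : ℂ_[3])‖ = 1) → ∀ (T :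
      Finset (IsDedekindDomain.HeightOneSpectrum (NumberField.RingOfIntegers K))) (c :
      IsDedekindDomain.HeightOneSpectrum (NumberField.RingOfIntegers K) → ℕ), (↑T = {v :
      IsDedekindDomain.HeightOneSpectrum (NumberField.RingOfIntegers K) | ((3 : ℕ) : NumberField.RingOfIntegers K)
      ∉ v.asIdeal ∧ (¬ (W.baseChange K).HasGoodReductionAt v ∨ ¬ (W'.baseChange K).HasGoodReductionAt v)}) → (∀ v
      ∈ T, (∃ d₀ : Literature.NumberTheory.EllipticCurves.GreenbergSelmer.decomp (K := K) v, (κ (d₀ :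
      Field.absoluteGaloisGroup K)).toAdd = (3 : ℤ_[3]) ^ c v) ∧ (∀ d :
      Literature.NumberTheory.EllipticCurves.GreenbergSelmer.decomp (K := K) v, (3 : ℤ_[3]) ^ c v ∣ (κ (d :
      Field.absoluteGaloisGroup K)).toAdd)) →
      ∃ (e : IsDedekindDomain.HeightOneSpectrum (NumberField.RingOfIntegers K) → ℤ_[3]),
        (∀ v ∈ T, e v ≠ 0 ∧ (e v).valuation = c v) ∧
        ∃ (P Q P' Q' : Literature.NumberTheory.EllipticCurves.UnrSeries 3),
        (∃ (a b : Literature.NumberTheory.EllipticCurves.unrIntegers 3)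
            (w : Literature.NumberTheory.EllipticCurves.UnrSeries 3), a ≠ 0 ∧ b ≠ 0 ∧ IsUnit w ∧
          PowerSeries.C a * (L * PowerSeries.map (Summit.BirchSwinnertonDyer.Rank1Residual.X11b.Halves.toUnr 3)
            (∏ v ∈ T, (Polynomial.aeval
              (PowerSeries.C ((Nat.card (IsLocalRing.ResidueField (v.adicCompletionIntegers K)) : ℤ_[3]).inv) *
                PowerSeries.binomialSeries ℤ_[3] (e v)) ((W.baseChange K).localPolynomialAt v) :
              Literature.NumberTheory.EllipticCurves.IwasawaAlgebra 3))) =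
          PowerSeries.C b * (w * (P * Q))) ∧
        (∃ (a' b' : Literature.NumberTheory.EllipticCurves.unrIntegers 3)
            (w' : Literature.NumberTheory.EllipticCurves.UnrSeries 3), a' ≠ 0 ∧ b' ≠ 0 ∧ IsUnit w' ∧
          PowerSeries.C a' * (L' * PowerSeries.map (Summit.BirchSwinnertonDyer.Rank1Residual.X11b.Halves.toUnr 3)
            (∏ v ∈ T, (Polynomial.aeval
              (PowerSeries.C ((Nat.card (IsLocalRing.ResidueField (v.adicCompletionIntegers K)) : ℤ_[3]).inv) *
                PowerSeries.binomialSeries ℤ_[3] (e v)) ((W'.baseChange K).localPolynomialAt v) :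
              Literature.NumberTheory.EllipticCurves.IwasawaAlgebra 3))) =
          PowerSeries.C b' * (w' * (P' * Q'))) ∧
        (∃ i : ℕ, ‖((PowerSeries.coeff i P : Literature.NumberTheory.EllipticCurves.unrIntegers 3) : ℂ_[3])‖ = 1) ∧
        (∃ i : ℕ, ‖((PowerSeries.coeff i Q : Literature.NumberTheory.EllipticCurves.unrIntegers 3) : ℂ_[3])‖ = 1) ∧
        (∃ i : ℕ, ‖((PowerSeries.coeff i P' : Literature.NumberTheory.EllipticCurves.unrIntegers 3) : ℂ_[3])‖ = 1) ∧
        (∃ i : ℕ, ‖((PowerSeries.coeff i Q' : Literature.NumberTheory.EllipticCurves.unrIntegers 3) : ℂ_[3])‖ = 1) ∧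
        (∃ V : Literature.NumberTheory.EllipticCurves.UnrSeries 3, ∀ i : ℕ,
          ‖((PowerSeries.coeff i (P' - V * P) : Literature.NumberTheory.EllipticCurves.unrIntegers 3) : ℂ_[3])‖ < 1) ∧
        (∃ V₂ : Literature.NumberTheory.EllipticCurves.UnrSeries 3, ∀ i : ℕ,
          ‖((PowerSeries.coeff i (Q' - V₂ * Q) : Literature.NumberTheory.EllipticCurves.unrIntegers 3) : ℂ_[3])‖ < 1)

/-- Coefficientwise `‖·‖ < 1` is symmetric under `A − B ↦ B − A`. [folklore] -/
theorem forall_norm_coeff_sub_lt_one_comm {A B : UnrSeries 3}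
    (h : ∀ i : ℕ, ‖((PowerSeries.coeff i (A - B) : unrIntegers 3) : ℂ_[3])‖ < 1) :
    ∀ i : ℕ, ‖((PowerSeries.coeff i (B - A) : unrIntegers 3) : ℂ_[3])‖ < 1 := by
  intro i
  have := h i
  rw [← neg_sub, map_neg] at this
  simpa only [NegMemClass.coe_neg, norm_neg] using this

/-- **Divisibility mod `𝔪` bounds profiles from below**: if `P` has profile `f`, `P′` has profile `f′` and `P′ ≡ V·P (mod 𝔪)`
for some `V`, then `f ≤ f′` (below `f` every coefficient of `V·P` is a sum of terms `V_j P_k` with `‖P_k‖ < 1`). [folklore]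
[cite: Washington1997, §7.1] -/
theorem profile_le_of_forall_norm_sub_mul_lt {P P' V : UnrSeries 3} {f f' : ℕ}
    (hP : (∀ i < f, ‖((PowerSeries.coeff i P : unrIntegers 3) : ℂ_[3])‖ < 1) ∧
      ‖((PowerSeries.coeff f P : unrIntegers 3) : ℂ_[3])‖ = 1)
    (hP' : (∀ i < f', ‖((PowerSeries.coeff i P' : unrIntegers 3) : ℂ_[3])‖ < 1) ∧
      ‖((PowerSeries.coeff f' P' : unrIntegers 3) : ℂ_[3])‖ = 1)
    (hV : ∀ i : ℕ, ‖((PowerSeries.coeff i (P' - V * P) : unrIntegers 3) : ℂ_[3])‖ < 1) : f ≤ f' := by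
  refine le_of_not_gt fun h ↦ ?_
  have hVP := normProfile_of_forall_norm_sub_lt (forall_norm_coeff_sub_lt_one_comm hV) hP'
  have hlt := norm_coeff_mul_lt_one_of_lt V hP.1 f' h
  exact absurd hVP.2 (ne_of_lt hlt)

/-- **U ⇒ D** (certifies the tag "D WEAKER than U"): take `V = V₂ = 1`; the wild roots inherit `μ = 0` from the congruence. -/
theorem universalPeriodDominance_of_universalPeriodPair (hU : UniversalPeriodPairAtThree) :
    UniversalPeriodDominanceAtThree := by
  intro W _ _ W' _ _ N N' _ _ K _ _ Dt Dt' hO6 hsurj hrk hN hmod haddv hN' hK hH hH' κ hκ γ _ 𝔭 h𝔭 hram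
      hdeg 𝔭' h𝔭' hne ι' hι ΩK Ωp L hΩK hΩp hL ΩK' Ωp' L' hΩK' hΩp' hL' hi' T c hT hc
  obtain ⟨e, he, P, Q, P', Q', hwild, htwin, hiP', hiQ', hcP, hcQ⟩ :=
    hU W W' N N' K Dt Dt' hO6 hsurj hrk hN hmod haddv hN' hK hH hH' κ hκ γ 𝔭 h𝔭 hram hdeg 𝔭' h𝔭' hne ι' hι ΩK Ωp L
      hΩK hΩp hL ΩK' Ωp' L' hΩK' hΩp' hL' hi' T c hT hc
  haveI : Fact (Nat.Prime 3) := ⟨Nat.prime_three⟩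
  obtain ⟨fP, hFP'⟩ := UniversalToricDescentSelfMuZero.exists_normProfile_of_exists_coeff_norm_eq_one hiP'
  obtain ⟨fQ, hFQ'⟩ := UniversalToricDescentSelfMuZero.exists_normProfile_of_exists_coeff_norm_eq_one hiQ'
  have hFP := normProfile_of_forall_norm_sub_lt hcP hFP'
  have hFQ := normProfile_of_forall_norm_sub_lt hcQ hFQ'
  refine ⟨e, he, P, Q, P', Q', hwild, htwin, ⟨fP, hFP.2⟩, ⟨fQ, hFQ.2⟩, hiP', hiQ', ⟨1, ?_⟩, ⟨1, ?_⟩⟩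
  · simpa only [one_mul] using forall_norm_coeff_sub_lt_one_comm hcP
  · simpa only [one_mul] using forall_norm_coeff_sub_lt_one_comm hcQ

/-- **D ⇒ ♭T≤** (the parent `DefectTransportModThreePT` = stmt-BirchSwinnertonDyer-23042 BY NAME, via the landed one-sided
consumer p706556 `defectTransportModThreePT_of_thmB_of_lambdaLe`): profiles `m + D = f_P + f_Q ≤ f_{P′} + f_{Q′} = m′ + D′`. -/
theorem defectTransportModThreePT_of_universalPeriodDominance
    (hB : Literature.NumberTheory.EllipticCurves.Hsieh2014.thmB_exists_isHsiehLFunction_coeff_norm_eq_one_unrPeriod_anyLevel)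
    (hD : UniversalPeriodDominanceAtThree) : DefectTransportModThreePT := by
  haveI : Fact (Nat.Prime 3) := ⟨Nat.prime_three⟩
  refine UniversalToricDescentDefectTransportModThreePTOfLambdaLe.defectTransportModThreePT_of_thmB_of_lambdaLe hB ?_
  intro W _ _ W' _ _ N N' _ _ K _ _ Dt Dt' hO6 hsurj hrk hN hmod haddv hN' hK hH hH' κ hκ γ _ 𝔭 h𝔭 hram
      hdeg 𝔭' h𝔭' hne ι' hι ΩK Ωp L hΩK hΩp hL ΩK' Ωp' L' hΩK' hΩp' hL' hi' T c hT hc m m' hm hm'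
  obtain ⟨e, he, P, Q, P', Q', ⟨a, b, w, ha, hb, hw, hEq⟩, ⟨a', b', w', ha', hb', hw', hEq'⟩, hiP, hiQ, hiP', hiQ',
      ⟨V, hV⟩, ⟨V₂, hV₂⟩⟩ :=
    hD W W' N N' K Dt Dt' hO6 hsurj hrk hN hmod haddv hN' hK hH hH' κ hκ γ 𝔭 h𝔭 hram hdeg 𝔭' h𝔭' hne ι' hι ΩK Ωp L
      hΩK hΩp hL ΩK' Ωp' L' hΩK' hΩp' hL' hi' T c hT hc
  have hT3 := UniversalToricDescentSigmaCongruenceInvariantPair.not_mem_of_coe_eq hT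
  obtain ⟨-, hordE⟩ := order_map_toZMod_prod_aeval_localPolynomialAt (W.baseChange K) T hT3 e
    (fun v hv ↦ (he v hv).1)
  obtain ⟨-, hordE'⟩ := order_map_toZMod_prod_aeval_localPolynomialAt (W'.baseChange K) T hT3 e
    (fun v hv ↦ (he v hv).1)
  have hX := normProfile_mul hm (normProfile_map_toUnr_of_order_eq _ hordE)
  have hX' := normProfile_mul hm' (normProfile_map_toUnr_of_order_eq _ hordE')
  obtain ⟨fP, hFP⟩ := UniversalToricDescentSelfMuZero.exists_normProfile_of_exists_coeff_norm_eq_one hiP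
  obtain ⟨fQ, hFQ⟩ := UniversalToricDescentSelfMuZero.exists_normProfile_of_exists_coeff_norm_eq_one hiQ
  obtain ⟨fP', hFP'⟩ := UniversalToricDescentSelfMuZero.exists_normProfile_of_exists_coeff_norm_eq_one hiP'
  obtain ⟨fQ', hFQ'⟩ := UniversalToricDescentSelfMuZero.exists_normProfile_of_exists_coeff_norm_eq_one hiQ'
  have hleP : fP ≤ fP' := profile_le_of_forall_norm_sub_mul_lt hFP hFP' hV
  have hleQ : fQ ≤ fQ' := profile_le_of_forall_norm_sub_mul_lt hFQ hFQ' hV₂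
  have hwPQ := normProfile_mul_of_isUnit hw (normProfile_mul hFP hFQ)
  have hwPQ' := normProfile_mul_of_isUnit hw' (normProfile_mul hFP' hFQ')
  have h1 := profile_eq_of_C_mul_eq ha hb hX hwPQ hEq
  have h2 := profile_eq_of_C_mul_eq ha' hb' hX' hwPQ' hEq'
  have key : ∀ E : WeierstrassCurve K,
      ∑ v ∈ T, (eulerFactorModP E 3 v).rootMultiplicity
            (((Nat.card (IsLocalRing.ResidueField (v.adicCompletionIntegers K)) : ℕ) : ZMod 3)⁻¹) *
          3 ^ (e v).valuation =
        ∑ v ∈ T, 3 ^ c v * (eulerFactorModP E 3 v).rootMultiplicity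
            (((Nat.card (IsLocalRing.ResidueField (v.adicCompletionIntegers K)) : ℕ) : ZMod 3)⁻¹) :=
    fun E ↦ Finset.sum_congr rfl fun v hv ↦ by rw [(he v hv).2, mul_comm]
  rw [← key, ← key]
  omega

end Summit.BirchSwinnertonDyer.BirchSwinnertonDyer.Cruxes.SigmaCongruenceAtThree.UniversalPeriodPair

end
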